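import Summits.QuantumFields.GaugeBoot.SquarePositiveFunctionals
import Mathlib.MeasureTheory.Integral.RieszMarkovKakutani.Real
import HarnessLib

/-!
# Square-positive normalised functionals on a dense translation-finite algebra are probability measures (gauge-boot, L1 supplement)

HONEST FRAMING (cell `pub-gaugeboot`, page 1 of every file): the venture produces certified bounds
on lattice expectations at stated coupling, gauge group, dimension and torus size; NOT a mass gap,
NOT a continuum limit, NOT a string tension; NOT Yang–Mills-summit-bearing (barriers
`FixedCouplingUltralocality`, `PerturbativeInvisibility`). Structural; it certifies no number.

## Content (realisability: the moment problem on a compact group)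

`Ω` compact Hausdorff second-countable group, `A ≤ C(Ω, ℝ)` dense and translation finite,
`φ : C(Ω, ℝ) →ₗ[ℝ] ℝ` with `φ 1 = 1` and `0 ≤ φ (a a)` for `a ∈ A`.

* `exists_positive_clm_of_sqPositive` — `φ|_A` extends to a POSITIVE continuous functional `Λ` on
  `C(Ω, ℝ)` with `Λ 1 = 1` (`|φ a| ≤ ‖a‖` from `SquarePositiveFunctionals.lean`, Hahn–Banach,
  positivity by density);
* ★★★ `exists_probabilityMeasure_of_sqPositive` — REALISABILITY: there is a Borel probability
  measure `μ` on `Ω` with `∫ a dμ = φ a` for every `a ∈ A` (Riesz–Markov–Kakutani,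
  `RealRMK.rieszMeasure`); `measure_eq_of_forall_integral_eq_of_dense` — it is unique.

For the lattice bootstrap (`Ω = ι → G`, `A` = polynomial observables, sequel
`PolynomialFunctionalsRealisable.lean`): "all moment matrices PSD + normalisation" already FORCES
the putative expectation values to be those of a probability measure on the configurations —
the realisability hypothesis of the completeness theorems of `PolynomialSchwingerDyson.lean` is
then automatic.

References: Berg–Christensen–Ressel, Harmonic Analysis on Semigroups (1984) §4.2 (archimedean
route to the same conclusion); F. Riesz / A. Markov / S. Kakutani (Mathlib `RealRMK`). Folklore.
-/

noncomputable section

open MeasureTheory Filter Topology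
open scoped CompactlySupported
open Literature.MathematicalPhysics.QuantumFieldTheory (haarProbability)

namespace Summit.QuantumFields.GaugeBoot

variable {Ω : Type*} [Group Ω] [TopologicalSpace Ω] [IsTopologicalGroup Ω] [CompactSpace Ω]
  [MeasurableSpace Ω] [BorelSpace Ω] [SecondCountableTopology Ω] [T2Space Ω]
  {A : Subalgebra ℝ C(Ω, ℝ)}

/-! ## Integration against a finite measure is continuous on `C(Ω, ℝ)` -/

omit [Group Ω] [IsTopologicalGroup Ω] [BorelSpace Ω] [SecondCountableTopology Ω] [T2Space Ω] in
/-- `K ↦ ∫ K dρ` is (Lipschitz) continuous on `C(Ω, ℝ)` for a finite measure `ρ`. [folklore] -/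
theorem continuous_integral_continuousMap [OpensMeasurableSpace Ω] (ρ : Measure Ω)
    [IsFiniteMeasure ρ] : Continuous fun K : C(Ω, ℝ) => ∫ x, K x ∂ρ := by
  have hi : ∀ K : C(Ω, ℝ), Integrable (fun x => K x) ρ := fun K =>
    integrable_of_continuous_compact K.continuous ρ
  refine (LipschitzWith.of_dist_le_mul (K := Real.toNNReal (ρ.real Set.univ))
    (f := fun K : C(Ω, ℝ) => ∫ x, K x ∂ρ) fun K₁ K₂ => ?_).continuous
  rw [Real.dist_eq, Real.coe_toNNReal _ measureReal_nonneg, ← integral_sub (hi K₁) (hi K₂)]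
  calc |∫ x, (K₁ x - K₂ x) ∂ρ| ≤ ∫ x, |K₁ x - K₂ x| ∂ρ := abs_integral_le_integral_abs
    _ ≤ ∫ _, dist K₁ K₂ ∂ρ :=
        integral_mono ((hi K₁).sub (hi K₂)).abs (integrable_const _) fun x => by
          rw [← Real.dist_eq]
          exact K₁.dist_apply_le_dist x
    _ = ρ.real Set.univ * dist K₁ K₂ := by rw [integral_const, smul_eq_mul]

omit [Group Ω] [IsTopologicalGroup Ω] in
/-- **Uniqueness**: two finite measures which agree on a dense subset of `C(Ω, ℝ)` are equal (the
compact metrisable space has outer-regular closed sets, `HasOuterApproxClosed`). [folklore] -/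
theorem measure_eq_of_forall_integral_eq_of_dense
    (hd : ∀ f : C(Ω, ℝ), f ∈ closure (A : Set C(Ω, ℝ))) (μ ν : Measure Ω) [IsFiniteMeasure μ]
    [IsFiniteMeasure ν] (h : ∀ a ∈ A, ∫ x, a x ∂μ = ∫ x, a x ∂ν) : μ = ν := by
  have key : ∀ f : C(Ω, ℝ), ∫ x, f x ∂μ = ∫ x, f x ∂ν := fun f =>
    (isClosed_eq (continuous_integral_continuousMap μ)
      (continuous_integral_continuousMap ν)).closure_subset_iff.2 (fun K hK => h K hK) (hd f)
  exact ext_of_forall_integral_eq_of_IsFiniteMeasure fun g => key g.toContinuousMap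

/-! ## Extension to a positive continuous functional -/

/-- **Hahn–Banach step.** A normalised square-positive `φ` on the dense translation-finite `A`
agrees on `A` with a continuous linear functional `Λ` of `C(Ω, ℝ)` which is POSITIVE and
normalised. [folklore] -/
theorem exists_positive_clm_of_sqPositive (hA : IsTranslationFinite A)
    (hd : ∀ f : C(Ω, ℝ), f ∈ closure (A : Set C(Ω, ℝ))) {φ : C(Ω, ℝ) →ₗ[ℝ] ℝ} (h1 : φ 1 = 1)
    (hpos : ∀ a ∈ A, 0 ≤ φ (a * a)) :
    ∃ Λ : C(Ω, ℝ) →L[ℝ] ℝ, (∀ a ∈ A, Λ a = φ a) ∧ (∀ f : C(Ω, ℝ), 0 ≤ f → 0 ≤ Λ f) ∧ Λ 1 = 1 := by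
  -- `φ|_A` is bounded by the sup norm
  set f₀ : Subalgebra.toSubmodule A →ₗ[ℝ] ℝ := φ.domRestrict (Subalgebra.toSubmodule A) with hf₀
  have hb : ∀ x : Subalgebra.toSubmodule A, ‖f₀ x‖ ≤ 1 * ‖x‖ := fun x => by
    rw [one_mul, hf₀, LinearMap.domRestrict_apply, Real.norm_eq_abs]
    exact abs_le_norm_of_sqPositive hA hd h1 hpos x.2
  obtain ⟨Λ, hΛ, hΛn⟩ := exists_extension_norm_eq (Subalgebra.toSubmodule A) (f₀.mkContinuous 1 hb)
  have hΛA : ∀ a ∈ A, Λ a = φ a := fun a ha => by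
    simpa [hf₀] using hΛ ⟨a, ha⟩
  have hΛ1 : ‖Λ‖ ≤ 1 := hΛn ▸ LinearMap.mkContinuous_norm_le _ zero_le_one _
  refine ⟨Λ, hΛA, fun f hf => ?_, by rw [hΛA 1 A.one_mem, h1]⟩
  -- positivity by density: `Λ f ≥ φ a - ‖a - f‖ ≥ -2 ‖a - f‖` for `a ∈ A` close to `f`
  refine le_of_forall_pos_le_add fun ε hε => ?_
  obtain ⟨a, haA, hfa⟩ := Metric.mem_closure_iff.1 (hd f) (ε / 2) (half_pos hε)
  have hnorm : ‖a - f‖ < ε / 2 := by rwa [← dist_eq_norm, dist_comm]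
  have hφa : -(ε / 2) ≤ φ a := le_of_sqPositive hA hd h1 hpos haA fun x => by
    have h1' := (a - f).norm_coe_le_norm x
    rw [ContinuousMap.sub_apply, Real.norm_eq_abs, abs_le] at h1'
    have h2' : 0 ≤ f x := by simpa using ContinuousMap.le_def.1 hf x
    linarith [h1'.1]
  have hΛfa : |Λ (f - a)| ≤ ‖f - a‖ := by
    rw [← Real.norm_eq_abs]
    exact (Λ.le_opNorm _).trans (by nlinarith [norm_nonneg (f - a)])
  have he : Λ f = φ a + Λ (f - a) := by rw [map_sub, hΛA a haA]; ring
  rw [he]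
  have h3 := (abs_le.1 hΛfa).1
  have h4 : ‖f - a‖ < ε / 2 := by rwa [norm_sub_rev]
  linarith

/-! ## Realisability (Riesz–Markov–Kakutani) -/

/-- ★★★ **Realisability.** A normalised linear functional which is square-positive on a dense
translation-finite subalgebra `A ≤ C(Ω, ℝ)` of a compact group IS integration against a Borel
probability measure on `Ω`, on every element of `A`. [folklore] -/
theorem exists_probabilityMeasure_of_sqPositive (hA : IsTranslationFinite A)
    (hd : ∀ f : C(Ω, ℝ), f ∈ closure (A : Set C(Ω, ℝ))) {φ : C(Ω, ℝ) →ₗ[ℝ] ℝ} (h1 : φ 1 = 1)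
    (hpos : ∀ a ∈ A, 0 ≤ φ (a * a)) :
    ∃ μ : Measure Ω, IsProbabilityMeasure μ ∧ ∀ a ∈ A, ∫ x, a x ∂μ = φ a := by
  obtain ⟨Λ, hΛA, hΛpos, hΛ1⟩ := exists_positive_clm_of_sqPositive hA hd h1 hpos
  let Λp : C_c(Ω, ℝ) →ₚ[ℝ] ℝ :=
    { toFun := fun g => Λ g.toContinuousMap
      map_add' := fun g g' => by
        have e : (g + g').toContinuousMap = g.toContinuousMap + g'.toContinuousMap := rfl
        simp only [e, map_add]
      map_smul' := fun c g => by
        have e : (c • g).toContinuousMap = c • g.toContinuousMap := rfl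
        simp only [e, map_smul, RingHom.id_apply]
      monotone' := fun g g' hle => by
        have h := hΛpos (g'.toContinuousMap - g.toContinuousMap) (ContinuousMap.le_def.2 fun x => by
          simpa using hle x)
        rw [map_sub] at h
        simpa using h }
  set μ := RealRMK.rieszMeasure Λp with hμ
  have hint : ∀ f : C(Ω, ℝ), ∫ x, f x ∂μ = Λ f := fun f =>
    RealRMK.integral_rieszMeasure Λp ⟨f, HasCompactSupport.of_compactSpace f⟩
  have huniv : μ Set.univ = 1 := by
    have h := hint 1
    simp only [ContinuousMap.one_apply, integral_const, smul_eq_mul, mul_one, measureReal_def] at h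
    rw [hΛ1] at h
    exact (ENNReal.toReal_eq_one_iff _).1 h
  exact ⟨μ, ⟨huniv⟩, fun a ha => by rw [hint, hΛA a ha]⟩

end Summit.QuantumFields.GaugeBoot

end
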